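import Summits.ValiantsHypothesis.ValiantsHypothesis.Theorems.LacunarySymmetroidMatrixDescartesStubKernelData
import Summits.ValiantsHypothesis.ValiantsHypothesis.Theorems.SymmetroidDescartesDerivedPencilRolleQuasiPsdSector
import Summits.ValiantsHypothesis.ValiantsHypothesis.Theorems.SymmetroidDescartesDerivedPencilRolleQuasiPsdSectorMultFrame
import Summits.ValiantsHypothesis.ValiantsHypothesis.Theorems.SymmetroidDescartesDerivedPencilRolleQuasiPsdSectorMultChain

/-!
# Crux `DerivedPencilRolleQuasi` (stmt-ValiantsHypothesis-18064) — the PSD sector WITH MULTIPLICITY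
# (= the PSD sector of the line's live stub `QuasiBoundMult` / C⁺ and of `HajosRung`)

**Theorem (`card_posRoots_mult_le`).**  Let `J` be a real symmetric `ι × ι` matrix, `P k ⪰ 0`
positive semidefinite, `a k ∈ ℕ`.  Then the determinant of the lacunary pencil
`J + ∑ₖ X^{a k} • P k` has at most `card ι` positive real roots COUNTED WITH MULTIPLICITY.

The distinct-root version is the tree's `firstRung_low` / `stub_loewner_rung` / `psdSector_*`.
Multiplicities need two further facts, landed as helpers of this crux:
* multiplicity = nullity (`DerivedPencilRolleQuasiPsdSectorMult.rootMultiplicity_det_eq_card`,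
  file `…PsdSectorMultFrame`): at a positive root `τ` the derivative
  `∑ₖ a_k τ^{a_k − 1} P k` of the pencil is positive on `ker G(τ)` unless the determinant vanishes
  identically, so `mult_τ(det) = dim ker G(τ)` ("semisimple real eigenvalues" of definite-type
  pencils);
* the grouped inertia chain (`…PsdSectorMult.sum_card_le`, file `…PsdSectorMultChain`): the
  kernels at distinct positive roots are independent subspaces, so `∑_τ dim ker G(τ) ≤ card ι`.

Corollaries in the crux's vocabulary (`Fin (K+1)`-indexed pencils, head `S 0` symmetric, tail
`S (l+1) ⪰ 0`): `psdSector_card_posRoots_mult_le` (`≤ m`, factor `X^{d 0}` out),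
`psdSector_rootMultiplicity_le` (every positive root — e.g. `t = 1`, the Hajós rung — has
multiplicity `≤ m`) and `psdSector_mult` (the multiplicity-counted budget
`(K+1)^(A·K) · 2^((log₂ m+2)^A)` for all `A ≥ 1`, i.e. the PSD sector of the registered stub
`QuasiBoundMult` of line `Sketch`, stated with its definitions `pencil`/`posRootCountMult` unfolded).
-/

-- single-conjunct layout: Sub = Summit, duplicated namespace component intended
set_option linter.dupNamespace false

namespace Summit.ValiantsHypothesis.ValiantsHypothesis.Theorems.SymmetroidDescartes

open Polynomial Matrix Finset
open scoped BigOperators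

namespace DerivedPencilRolleQuasiPsdSectorMult

/-- Entrywise evaluation of the head–tail pencil `J + ∑ₖ X^{a k} • P k` at a real point. -/
theorem map_eval_headTail {ι κ : Type*} [Fintype κ] (a : κ → ℕ) (J : Matrix ι ι ℝ)
    (P : κ → Matrix ι ι ℝ) (s : ℝ) :
    (J.map C + ∑ k, (X : ℝ[X]) ^ a k • (P k).map C).map (eval s) = J + ∑ k, (s ^ a k) • P k := by
  refine Matrix.ext fun i j => ?_
  simp only [Matrix.map_apply, Matrix.add_apply, Matrix.sum_apply, Matrix.smul_apply, smul_eq_mul,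
    eval_add, eval_finsetSum, eval_mul, eval_pow, eval_X, eval_C]

/-- Entrywise derivative of the head–tail pencil at a real point:
`(J + ∑ₖ X^{a k} • P k)′(τ) = ∑ₖ (a k · τ^{a k − 1}) • P k`. -/
theorem map_derivative_eval_headTail {ι κ : Type*} [Fintype κ] (a : κ → ℕ) (J : Matrix ι ι ℝ)
    (P : κ → Matrix ι ι ℝ) (τ : ℝ) :
    (J.map C + ∑ k, (X : ℝ[X]) ^ a k • (P k).map C).map (fun q => (derivative q).eval τ)
      = ∑ k, ((a k : ℝ) * τ ^ (a k - 1)) • P k := by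
  refine Matrix.ext fun i j => ?_
  simp only [Matrix.map_apply, Matrix.add_apply, Matrix.sum_apply, Matrix.smul_apply, smul_eq_mul,
    derivative_add, derivative_C, derivative_sum, derivative_mul, derivative_X_pow, zero_add,
    mul_zero, add_zero, eval_finsetSum, eval_mul, eval_C, eval_pow, eval_X]

/-- **PSD sector with multiplicity (head–tail form).**  For `J` real symmetric and `P k ⪰ 0`, the
determinant of `J + ∑ₖ X^{a k} • P k` has at most `card ι` positive real roots counted WITH
multiplicity. -/
theorem card_posRoots_mult_le (ι κ : Type) [Fintype ι] [DecidableEq ι] [Fintype κ] (a : κ → ℕ)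
    (J : Matrix ι ι ℝ) (P : κ → Matrix ι ι ℝ) (hJ : J.IsSymm) (hP : ∀ k, (P k).PosSemidef) :
    Multiset.card ((Matrix.det (J.map C + ∑ k, (X : ℝ[X]) ^ a k • (P k).map C)).roots.filter
      (fun t => 0 < t)) ≤ Fintype.card ι := by
  classical
  set M : Matrix ι ι ℝ[X] := J.map C + ∑ k, (X : ℝ[X]) ^ a k • (P k).map C with hM
  set p : ℝ[X] := M.det with hp
  by_cases hp0 : p = 0
  · rw [hp0, roots_zero, Multiset.filter_zero, Multiset.card_zero]
    exact Nat.zero_le _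
  -- the real matrix family and its basic properties
  set Gm : ℝ → Matrix ι ι ℝ := fun s => J + ∑ k, (s ^ a k) • P k with hGm
  have hMeval : ∀ s, M.map (eval s) = Gm s := fun s => map_eval_headTail a J P s
  have hpeval : ∀ s, p.eval s = (Gm s).det := by
    intro s
    have h := RingHom.map_det (evalRingHom s) M
    rw [RingHom.mapMatrix_apply, coe_evalRingHom] at h
    rw [hp, h, hMeval]
  have hPk : ∀ k, (P k).IsSymm := fun k => Matrix.isHermitian_iff_isSymm.1 (hP k).1
  have hGsymm : ∀ s : ℝ, (Gm s).IsSymm := by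
    intro s
    change (J + ∑ k, (s ^ a k) • P k).IsSymm
    unfold Matrix.IsSymm
    rw [Matrix.transpose_add, Matrix.transpose_sum, hJ.eq]
    congr 1
    exact Finset.sum_congr rfl fun k _ => by rw [Matrix.transpose_smul, (hPk k).eq]
  have hmono : ∀ s t : ℝ, 0 < s → s ≤ t → (Gm t - Gm s).PosSemidef := by
    intro s t hs hst
    have hdiff : Gm t - Gm s = ∑ k, (t ^ a k - s ^ a k) • P k := by
      change (J + ∑ k, (t ^ a k) • P k) - (J + ∑ k, (s ^ a k) • P k) = _
      simp only [sub_smul, Finset.sum_sub_distrib]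
      abel
    rw [hdiff]
    refine Matrix.posSemidef_sum Finset.univ fun k _ => ?_
    exact (hP k).smul (sub_nonneg.2 (pow_le_pow_left₀ hs.le hst _))
  have hq : ∀ (k : κ) (y : ι → ℝ), 0 ≤ y ⬝ᵥ (P k *ᵥ y) := fun k y => by
    simpa only [star_trivial] using (hP k).dotProduct_mulVec_nonneg y
  -- strictness core: a nonzero kernel vector at a positive time sees a growing term
  have hcore : ∀ τ : ℝ, 0 < τ → ∀ y : ι → ℝ, Gm τ *ᵥ y = 0 → y ≠ 0 →
      ∃ k, a k ≠ 0 ∧ 0 < y ⬝ᵥ (P k *ᵥ y) := by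
    intro τ _hτ y hy hy0
    by_contra hcon
    push Not at hcon
    have hPy : ∀ k, a k ≠ 0 → P k *ᵥ y = 0 := fun k hk => by
      have h0 : y ⬝ᵥ (P k *ᵥ y) = 0 := le_antisymm (hcon k hk) (hq k y)
      have h := (hP k).dotProduct_mulVec_zero_iff y
      rw [star_trivial] at h
      exact h.1 h0
    have hall : ∀ s : ℝ, Gm s *ᵥ y = 0 := by
      intro s
      rw [← hy]
      change (J + ∑ k, (s ^ a k) • P k) *ᵥ y = (J + ∑ k, (τ ^ a k) • P k) *ᵥ y
      rw [LacunarySymmetroidMatrixDescartes.family_mulVec,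
        LacunarySymmetroidMatrixDescartes.family_mulVec]
      congr 1
      refine Finset.sum_congr rfl fun k _ => ?_
      rcases eq_or_ne (a k) 0 with h0 | h0
      · rw [h0, pow_zero, pow_zero]
      · rw [hPy k h0, smul_zero, smul_zero]
    exact hp0 (Polynomial.funext fun s => by
      rw [hpeval, Polynomial.eval_zero]
      exact Matrix.exists_mulVec_eq_zero_iff.1 ⟨y, hy0, hall s⟩)
  -- strictness for the chain: later quadratic forms of a kernel vector are positive
  have hstrict : ∀ τ : ℝ, 0 < τ → ∀ y : ι → ℝ, Gm τ *ᵥ y = 0 → y ≠ 0 →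
      ∀ s : ℝ, τ < s → 0 < y ⬝ᵥ (Gm s *ᵥ y) := by
    intro τ hτ y hy hy0 s hs
    obtain ⟨k₀, hk₀, hpos₀⟩ := hcore τ hτ y hy hy0
    have hquad0 : y ⬝ᵥ (J *ᵥ y) + ∑ k, τ ^ a k * (y ⬝ᵥ (P k *ᵥ y)) = 0 := by
      rw [← LacunarySymmetroidMatrixDescartes.dotProduct_family_mulVec a J P y τ]
      change y ⬝ᵥ (Gm τ *ᵥ y) = 0
      rw [hy, dotProduct_zero]
    have hquad : y ⬝ᵥ (Gm s *ᵥ y) = ∑ k, (s ^ a k - τ ^ a k) * (y ⬝ᵥ (P k *ᵥ y)) := by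
      change y ⬝ᵥ ((J + ∑ k, (s ^ a k) • P k) *ᵥ y) = _
      rw [LacunarySymmetroidMatrixDescartes.dotProduct_family_mulVec a J P y s,
        eq_neg_of_add_eq_zero_left hquad0]
      simp only [sub_mul, Finset.sum_sub_distrib]
      ring
    rw [hquad]
    have hterm : ∀ k, 0 ≤ (s ^ a k - τ ^ a k) * (y ⬝ᵥ (P k *ᵥ y)) := fun k =>
      mul_nonneg (sub_nonneg.2 (pow_le_pow_left₀ hτ.le hs.le _)) (hq k y)
    have hk₀term : 0 < (s ^ a k₀ - τ ^ a k₀) * (y ⬝ᵥ (P k₀ *ᵥ y)) :=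
      mul_pos (sub_pos.2 (pow_lt_pow_left₀ hs hτ.le hk₀)) hpos₀
    exact lt_of_lt_of_le hk₀term (Finset.single_le_sum (fun k _ => hterm k) (Finset.mem_univ k₀))
  -- derivative positivity on kernel vectors
  have hder : ∀ τ : ℝ, 0 < τ → ∀ y : ι → ℝ, Gm τ *ᵥ y = 0 → y ≠ 0 →
      0 < y ⬝ᵥ ((∑ k, ((a k : ℝ) * τ ^ (a k - 1)) • P k) *ᵥ y) := by
    intro τ hτ y hy hy0
    obtain ⟨k₀, hk₀, hpos₀⟩ := hcore τ hτ y hy hy0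
    have hquad : y ⬝ᵥ ((∑ k, ((a k : ℝ) * τ ^ (a k - 1)) • P k) *ᵥ y)
        = ∑ k, ((a k : ℝ) * τ ^ (a k - 1)) * (y ⬝ᵥ (P k *ᵥ y)) := by
      rw [Matrix.sum_mulVec, dotProduct_sum]
      simp only [Matrix.smul_mulVec, dotProduct_smul, smul_eq_mul]
    rw [hquad]
    have hterm : ∀ k, 0 ≤ ((a k : ℝ) * τ ^ (a k - 1)) * (y ⬝ᵥ (P k *ᵥ y)) := fun k =>
      mul_nonneg (mul_nonneg (Nat.cast_nonneg _) (pow_nonneg hτ.le _)) (hq k y)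
    have hk₀term : 0 < ((a k₀ : ℝ) * τ ^ (a k₀ - 1)) * (y ⬝ᵥ (P k₀ *ᵥ y)) :=
      mul_pos (mul_pos (Nat.cast_pos.2 (Nat.pos_of_ne_zero hk₀)) (pow_pos hτ _)) hpos₀
    exact lt_of_lt_of_le hk₀term (Finset.single_le_sum (fun k _ => hterm k) (Finset.mem_univ k₀))
  -- kernel frames at every time (part 1) and the positive roots
  choose b S hbS hcompl using fun τ : ℝ => exists_kernelFrame (Gm τ)
  set R : Finset ℝ := (p.roots.filter (fun t => 0 < t)).toFinset with hR
  have hRpos : ∀ t ∈ R, 0 < t := fun t ht => by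
    rw [hR, Multiset.mem_toFinset, Multiset.mem_filter] at ht
    exact ht.2
  -- multiplicity at each positive root = size of the kernel frame
  have hmult : ∀ t ∈ R, p.rootMultiplicity t = (S t).card := by
    intro t ht
    refine rootMultiplicity_det_eq_card M t (b t) (S t) ?_ ?_ ?_ ?_
    · rw [hMeval]
      exact hGsymm t
    · intro j hj
      rw [hMeval]
      exact hbS t j hj
    · intro c hc h
      rw [hMeval] at h
      exact hcompl t c hc h
    · intro c hc hc0
      rw [hM, map_derivative_eval_headTail]
      refine hder t (hRpos t ht) _ ?_ ?_
      · rw [Matrix.mulVec_sum]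
        refine Finset.sum_eq_zero fun j _ => ?_
        by_cases hj : j ∈ S t
        · rw [Matrix.mulVec_smul, hbS t j hj, smul_zero]
        · rw [hc j hj, zero_smul, Matrix.mulVec_zero]
      · intro h0
        exact hc0 (funext ((Fintype.linearIndependent_iff.1 (b t).linearIndependent) c h0))
  -- the grouped inertia chain (part 2) bounds the total size of the frames
  have hsumS : ∑ t ∈ R, (S t).card ≤ Fintype.card ι := by
    have h := sum_card_le Gm hGsymm hmono hstrict R hRpos (κ := fun t => ↥(S t))
      (fun t j => b t j) (fun t _ j => hbS t j j.2)
      (fun t _ => (b t).linearIndependent.comp _ Subtype.coe_injective)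
    simpa only [Fintype.card_coe] using h
  -- count with multiplicity
  calc Multiset.card (p.roots.filter (fun t => 0 < t))
        = ∑ t ∈ R, (p.roots.filter (fun t => 0 < t)).count t :=
          (Multiset.toFinset_sum_count_eq _).symm
    _ = ∑ t ∈ R, p.rootMultiplicity t := Finset.sum_congr rfl fun t ht => by
          rw [Multiset.count_filter_of_pos (hRpos t ht), Polynomial.count_roots]
    _ = ∑ t ∈ R, (S t).card := Finset.sum_congr rfl hmult
    _ ≤ Fintype.card ι := hsumS

end DerivedPencilRolleQuasiPsdSectorMult

open DerivedPencilRolleQuasiPsdSectorMult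

/-- **PSD sector with multiplicity, crux vocabulary.**  For a `(K+1)`-term lacunary pencil
`∑ₗ X^{d l} • S l` of real `m × m` matrices with symmetric head `S 0`, positive semidefinite tail
`S 1, …, S K` and minimal head exponent (`d 0 ≤ d l`), the determinant has at most `m` positive
real roots COUNTED WITH MULTIPLICITY. -/
theorem psdSector_card_posRoots_mult_le (m K : ℕ) (S : Fin (K + 1) → Matrix (Fin m) (Fin m) ℝ)
    (d : Fin (K + 1) → ℕ) (h0 : (S 0).IsSymm) (hpsd : ∀ l : Fin K, (S l.succ).PosSemidef)
    (hd : ∀ l, d 0 ≤ d l) :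
    Multiset.card (((∑ l, (Polynomial.X : Polynomial ℝ) ^ d l • (S l).map Polynomial.C).det).roots.filter
      (fun t => 0 < t)) ≤ m := by
  classical
  -- factor `X^{d 0}` out of the pencil
  set G : Matrix (Fin m) (Fin m) ℝ[X] :=
    (S 0).map C + ∑ l : Fin K, (X : ℝ[X]) ^ (d l.succ - d 0) • (S l.succ).map C with hG
  have hF : (∑ l, (Polynomial.X : Polynomial ℝ) ^ d l • (S l).map Polynomial.C)
      = (X : ℝ[X]) ^ d 0 • G := by
    rw [Fin.sum_univ_succ, hG, smul_add, Finset.smul_sum]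
    congr 1
    refine Finset.sum_congr rfl fun l _ => ?_
    rw [smul_smul, ← pow_add, Nat.add_sub_cancel' (hd l.succ)]
  have hdet : (∑ l, (Polynomial.X : Polynomial ℝ) ^ d l • (S l).map Polynomial.C).det
      = (X : ℝ[X]) ^ (d 0 * m) * G.det := by
    rw [hF, Matrix.det_smul, Fintype.card_fin, ← pow_mul]
  have hGle : Multiset.card (G.det.roots.filter (fun t => 0 < t)) ≤ m := by
    have h := card_posRoots_mult_le (Fin m) (Fin K) (fun l => d l.succ - d 0) (S 0)
      (fun l => S l.succ) h0 hpsd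
    rwa [Fintype.card_fin] at h
  rw [hdet]
  by_cases hG0 : G.det = 0
  · rw [hG0, mul_zero, roots_zero, Multiset.filter_zero, Multiset.card_zero]
    exact Nat.zero_le _
  have hne : (X : ℝ[X]) ^ (d 0 * m) * G.det ≠ 0 := mul_ne_zero (pow_ne_zero _ X_ne_zero) hG0
  rw [roots_mul hne, roots_X_pow, Multiset.filter_add, Multiset.filter_nsmul,
    Multiset.filter_singleton, if_neg (lt_irrefl (0 : ℝ)), Multiset.empty_eq_zero, nsmul_zero,
    zero_add]
  exact hGle

/-- **PSD sector: every positive root has multiplicity at most `m`** (in particular the Hajós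
rung `t = 1` of card `hajos-krylov-valuation` holds on the sector with the sharp value `m`). -/
theorem psdSector_rootMultiplicity_le (m K : ℕ) (S : Fin (K + 1) → Matrix (Fin m) (Fin m) ℝ)
    (d : Fin (K + 1) → ℕ) (h0 : (S 0).IsSymm) (hpsd : ∀ l : Fin K, (S l.succ).PosSemidef)
    (hd : ∀ l, d 0 ≤ d l) (t : ℝ) (ht : 0 < t) :
    ((∑ l, (Polynomial.X : Polynomial ℝ) ^ d l • (S l).map Polynomial.C).det).rootMultiplicity t
      ≤ m := by
  classical
  rw [← Polynomial.count_roots, ← Multiset.count_filter_of_pos (p := fun t : ℝ => 0 < t) ht]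
  exact (Multiset.count_le_card _ _).trans (psdSector_card_posRoots_mult_le m K S d h0 hpsd hd)

/-- **PSD sector of the multiplicity-counted bound C⁺ (`QuasiBoundMult`, line `Sketch`).**  For
every `A ≥ 1`, every `(K+1)`-term lacunary pencil with real symmetric invertible coefficients,
strictly increasing exponents and positive semidefinite tail `S 1, …, S K` has at most
`(K+1)^(A·K) · 2^((log₂ m + 2)^A)` positive roots of its determinant counted WITH multiplicity
(indeed at most `m`).  This is `posRootCountMult d S ≤ …` of `Cruxes/…/Lines/Sketch.lean` with
`pencil`/`posRootCountMult` unfolded; the hypotheses beyond `S 0` symmetric are kept verbatim. -/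
theorem psdSector_mult (A : ℕ) (hA : 1 ≤ A) (m K : ℕ) (S : Fin (K + 1) → Matrix (Fin m) (Fin m) ℝ)
    (d : Fin (K + 1) → ℕ) (hS : ∀ l, (S l).IsSymm) (_hdet : ∀ l, (S l).det ≠ 0)
    (hd : StrictMono d) (hpsd : ∀ l : Fin K, (S l.succ).PosSemidef) :
    Multiset.card (((∑ l, (Polynomial.X : Polynomial ℝ) ^ d l • (S l).map Polynomial.C).det).roots.filter
      (fun t => 0 < t)) ≤ (K + 1) ^ (A * K) * 2 ^ (Nat.log 2 m + 2) ^ A := by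
  have h1 := psdSector_card_posRoots_mult_le m K S d (hS 0) hpsd fun l => hd.monotone (Fin.zero_le l)
  have h2 := DerivedPencilRolleQuasiPsdSector.le_quasiBudget m K 0 A 0 hA
  rw [zero_mul, zero_add] at h2
  exact h1.trans h2

/-- **Registered stub shape `stub_psdSectorMult`** (crux stmt-ValiantsHypothesis-18064; the PSD
sector of the live stub `QuasiBoundMult` of line `Sketch`, as a closed `Prop` with
`pencil`/`posRootCountMult` unfolded): for every `A ≥ 1`, lacunary pencils with real symmetric
invertible coefficients, strictly increasing exponents and positive semidefinite tail have at most
`(K+1)^(A·K) · 2^((log₂ m + 2)^A)` positive determinant roots COUNTED WITH MULTIPLICITY. -/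
theorem stub_psdSectorMult : ∀ (A : ℕ), 1 ≤ A → ∀ (m K : ℕ) (S : Fin (K + 1) → Matrix (Fin m) (Fin m) ℝ) (d : Fin (K + 1) → ℕ), (∀ l, (S l).IsSymm) → (∀ l, (S l).det ≠ 0) → StrictMono d → (∀ l : Fin K, (S l.succ).PosSemidef) → Multiset.card (((∑ l, (Polynomial.X : Polynomial ℝ) ^ d l • (S l).map Polynomial.C).det).roots.filter (fun t => 0 < t)) ≤ (K + 1) ^ (A * K) * 2 ^ (Nat.log 2 m + 2) ^ A :=
  fun A hA m K S d hS hdet hd hpsd => psdSector_mult A hA m K S d hS hdet hd hpsd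

end Summit.ValiantsHypothesis.ValiantsHypothesis.Theorems.SymmetroidDescartes
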